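import Literature.Computability.AlgebraicComplexity.AlmanLi2026IteratedSpectrumBound
import Literature.Computability.AlgebraicComplexity.AlmanLi2026GammaPrimeCertificate
import Literature.Computability.AlgebraicComplexity.AlmanLi2026SmallCW
import HarnessLib

/-!
# `R̃(cw_2) < 3.931` (Alman–Li 2026, Thm. 1.3) from the §7.1 iterated display

Topic `Literature/Computability/AlgebraicComplexity` (family `MatrixMultiplication`). Source: J. Alman,
B. Li, *Asymptotic Rank Speedup Theorems, Revisited*, arXiv:2605.21738 (2026), Thm. 1.3 (held text
`paper:arxiv-2605.21738`, p0004 L26: "`R̃(cw_2) < 3.931`"; p0002 L7) = Table 1's `γ'_2 = 3.931` at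
`q = 2`, `n = 4`, obtained in §7.1 (p0017 L100–122) from the iterated degeneration (Thm. 6.2 ∘
Prop. 7.1) by Strassen calculus, the maximum over `θ ∈ [2/3,1]` being attained at `θ = 2/3`.

This file assembles the printed route from tree pieces: the §7.1 display (the named fact
`AlmanLi2026_iteratedSpeedup_cw`, taken here as a HYPOTHESIS — its discharge is
`AlmanLi2026IteratedCWDischarge`), the certificate form of the Strassen-calculus step
(`AlmanLi2026.asymptoticRank_cwTensor_le_of_iterated_certificate`, `AlmanLi2026IteratedSpectrumBound`)
and the kernel certificate for the maximisation (`AlmanLi2026.gammaPrime_two_certificate`,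
`gammaPrime_two_root_lt`, `AlmanLi2026GammaPrimeCertificate`):
`AlmanLi2026.asymptoticRank_cwTwo_lt_of_iterated : AlmanLi2026_iteratedSpeedup_cw → R̃(cw_2) < 3.931`,
i.e. the tree's fact `AlmanLi2026_asymptoticRank_cwTwo_lt` modulo the display. No named facts.

## References

* J. Alman, B. Li, *Asymptotic Rank Speedup Theorems, Revisited*, arXiv:2605.21738 (2026), Thm. 1.3,
  §7.1, Table 1. [AlmanLi2026]
-/

noncomputable section

namespace Literature.Computability.AlgebraicComplexity

/-- **Alman–Li 2026, Thm. 1.3, modulo the §7.1 display**: if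
`cw_2^{⊗2n} ⊕ 2⊙cw_2^{⊗n}⊗⟨1,t,1⟩ ⊕ ⟨1,t²+2·3^{2n},1⟩ ⊴ (⟨4^n⟩ ⊕ ⟨1,2^n,1⟩)^{⊗2}` holds in the three
directions (the fact `AlmanLi2026_iteratedSpeedup_cw`, used at `q = 2`, `n = 4`, `t = 110`), then
`R̃(cw_2) < 3.931` (`R̃(cw_2) ≤ 238.7878^{1/4} < 3.931`). [cite: AlmanLi2026, Thm. 1.3 (§7.1, Table 1)] -/
theorem AlmanLi2026.asymptoticRank_cwTwo_lt_of_iterated (h : AlmanLi2026_iteratedSpeedup_cw) :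
    asymptoticRank (cwTensor ℂ 2) < 3.931 := by
  have hle := AlmanLi2026.asymptoticRank_cwTensor_le_of_iterated_certificate h (q := 2) (n := 4)
    (t := 110) (by norm_num) (by norm_num) (by norm_num) (by norm_num) (c := (1193939 / 5000 : ℝ))
    (by norm_num) (fun θ h₁ h₂ => by
      have hc := AlmanLi2026.gammaPrime_two_certificate θ h₁ h₂
      push_cast
      norm_num
      linarith [hc])
  have h4 : ((4 : ℕ) : ℝ)⁻¹ = (4 : ℝ)⁻¹ := by norm_num
  rw [h4] at hle
  exact hle.trans_lt AlmanLi2026.gammaPrime_two_root_lt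

end Literature.Computability.AlgebraicComplexity
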